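import Mathlib
import Summits.Schanuel.Schanuel.Theses.RigidCore
import Literature.NumberTheory.Transcendental.KernelTranslatesRankTwoSectors
import Literature.NumberTheory.Transcendental.LindemannWeierstrassProofs
import Summits.Schanuel.Schanuel.Theorems.MinimalCounterexampleInAcl.Negative.IsolationFree

/-!
# Mates of a rank-2 first failure, I: `𝒵_W ⊆ Z(m₀) × Z(m₁)` is closed discrete — crux stmt-Schanuel-0969

Route `RigidCore`, crux (S*) `MinimalCounterexampleInAcl` (item stmt-Schanuel-0969), line `kernel-arithmetic-selection`
(lead prover-line-stmt-Schanuel-0969-c6-0), landed `--supports stmt-Schanuel-0969`.  This makes IMPORTABLE the analytic toolkit of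
the crux disprover's work file `Cruxes/MinimalCounterexampleInAcl/DisproofRankTwo.lean` (refuter-cdisprove-stmt-Schanuel-0969-g4,
§18–§19; adapted verbatim up to spelling out its two helper definitions as local notation), on which the gen-19 skeleton's
SECOND-LEVEL SELECTION stubs rest (growth of the coefficients of a second-level relation along the mates).

For `x ∈ ℂ²` with `trdeg ℚ(x, eˣ) < 2` (e.g. a rank-2 first failure; neither linear independence nor `SchanuelRank` is
used), `W` = ℚ-locus of `(x, eˣ)`, `𝒵_W = {v | (v, e^v) ∈ W}` (its ℚ-independent points are the locus mates):
`exists_coord_expPoly` — each coordinate of every `v ∈ 𝒵_W` is a zero of a FIXED non-zero exponential polynomial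
`s ↦ mᵢ(e^s, s)`, `mᵢ ∈ ℚ[T, S]`; `expPoly_zeros_finite` (Hermite–Lindemann at a good rational point + identity theorem);
`locusPts_bounded_finite` (**bounded sets of locus points are FINITE**), `locusPts_bounded_finite_of_special` (any rank,
E-special tuples), `cruxRankTwo_of_bounded'` (with the landed `Negative.isolationFree`).
Part II (`…MateGrowthBounds`): Cauchy bound and `max(‖e^s‖, ‖e^{-s}‖) ≤ max 1 (C (1+‖s‖)^D)` on large zeros;
Part III (`…MateGrowthVertical`): `|Re s| = O(log ‖s‖)`, vertical escape, `exp_coord_polynomially_bounded`.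

Notation (local, no definitions): `expPoly[m, s] = MvPolynomial.aeval ![cexp s, s] m`.

## References

* [Lindemann1882] F. Lindemann, *Über die Zahl π*, Math. Ann. 20 (1882) (tree `transcendental_exp_holds`).
* [Polya1920] G. Pólya, *Geometrisches über die Verteilung der Nullstellen gewisser ganzer transzendenter
  Funktionen*, Münch. Sitzungsber. 50 (1920) (zeros of exponential polynomials lie in logarithmic strips).
-/

noncomputable section

set_option linter.dupNamespace false

open Complex Polynomial Set Filter Topology Bornology Finset
open Literature.NumberTheory.Transcendental
open Literature.NumberTheory.Transcendental.KernelTranslatesRankTwo (eval_map_finSuccEquiv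
  finite_setOf_aeval_eq_zero exists_mvPolynomial_of_trdeg_lt_two)
open Summit.Schanuel.Schanuel.Theorems.MinimalCounterexampleInAcl.Negative (isolationFree)
open Summit.Schanuel.Schanuel.Theorems.AclSubsetLogFreeCore.Negative (expAcl)

-- adapted from Cruxes/MinimalCounterexampleInAcl/DisproofRankTwo.lean (refuter-cdisprove-stmt-Schanuel-0969-g4, rc 0)
namespace Summit.Schanuel.Schanuel.Cruxes.MinimalCounterexampleInAcl.KernelArithmeticSelection.MateGrowth

/-- The one-variable exponential polynomial `s ↦ m(e^s, s)` attached to `m ∈ ℚ[T, S]` (local notation, no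
definition: `expPoly[m, s]` is literally `MvPolynomial.aeval ![cexp s, s] m`). -/
local notation3 "expPoly[" m ", " s "]" => (MvPolynomial.aeval ![Complex.exp s, s] m : ℂ)

/-- A coefficient `c ∈ ℚ[S]` (as `MvPolynomial (Fin 1) ℚ`) viewed as a complex polynomial (local notation, no
definition). -/
local notation3 "coefC[" c "]" =>
  (Polynomial.map (algebraMap ℚ ℂ) (MvPolynomial.uniqueAlgEquiv ℚ (Fin 1) c) : Polynomial ℂ)

/-- Read-back of the notation. -/
theorem expPoly_def (m : MvPolynomial (Fin 2) ℚ) (s : ℂ) :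
    expPoly[m, s] = MvPolynomial.aeval ![cexp s, s] m := rfl

/-- `s ↦ m(e^s, s)` is analytic everywhere. -/
theorem analyticAt_expPoly (m : MvPolynomial (Fin 2) ℚ) (s₀ : ℂ) :
    AnalyticAt ℂ (fun s => expPoly[m, s]) s₀ := by
  induction m using MvPolynomial.induction_on with
  | C a =>
    have e : (fun s : ℂ => MvPolynomial.aeval ![cexp s, s] (MvPolynomial.C a)) = fun _ => (a : ℂ) := by
      funext s; simp
    rw [e]; exact analyticAt_const
  | add p q hp hq =>
    have e : (fun s : ℂ => MvPolynomial.aeval ![cexp s, s] (p + q)) =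
        fun s => MvPolynomial.aeval ![cexp s, s] p + MvPolynomial.aeval ![cexp s, s] q := by
      funext s; simp
    rw [e]; exact hp.add hq
  | mul_X p i hp =>
    have e : (fun s : ℂ => MvPolynomial.aeval ![cexp s, s] (p * MvPolynomial.X i)) =
        fun s => MvPolynomial.aeval ![cexp s, s] p * (![cexp s, s] i) := by
      funext s; simp
    rw [e]
    refine hp.mul ?_
    fin_cases i
    · exact analyticAt_cexp
    · exact analyticAt_id

/-- **A non-zero `m ∈ ℚ[T, S]` gives a non-zero exponential polynomial**: there is a rational `q ≠ 0`
with `m(e^q, q) ≠ 0` (Hermite–Lindemann: `e^q` is transcendental, so it is not a root of the non-zero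
rational polynomial `m(·, q)` — non-zero for all `q` off the finitely many roots of the leading
coefficient). -/
theorem exists_rat_expPoly_ne_zero {m : MvPolynomial (Fin 2) ℚ} (hm : m ≠ 0) :
    ∃ q : ℚ, q ≠ 0 ∧ expPoly[m, q] ≠ 0 := by
  classical
  set M : Polynomial (MvPolynomial (Fin 1) ℚ) := MvPolynomial.finSuccEquiv ℚ 1 m with hM
  have hM0 : M ≠ 0 := by
    rw [hM]; exact (EmbeddingLike.map_ne_zero_iff).2 hm
  set L : MvPolynomial (Fin 1) ℚ := M.leadingCoeff with hL
  have hL0 : L ≠ 0 := Polynomial.leadingCoeff_ne_zero.2 hM0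
  -- the leading coefficient, as a polynomial in `S`, has finitely many complex roots
  set L2 : MvPolynomial (Fin 2) ℚ := MvPolynomial.rename (fun _ : Fin 1 => (0 : Fin 2)) L with hL2
  have hL20 : L2 ≠ 0 := by
    rw [hL2]
    exact (MvPolynomial.rename_injective _ (fun a b _ => Subsingleton.elim a b)).ne hL0
  have heval2 : ∀ z y : ℂ, MvPolynomial.aeval ![z, y] L2 = MvPolynomial.aeval (fun _ : Fin 1 => z) L := by
    intro z y
    rw [hL2, MvPolynomial.aeval_rename]
    rfl
  have htrans : Transcendental ℚ (cexp 1) := by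
    intro h
    exact transcendental_exp_holds (isAlgebraic_one) one_ne_zero h
  have hfin : {z : ℂ | MvPolynomial.aeval (fun _ : Fin 1 => z) L = 0}.Finite := by
    have h := finite_setOf_aeval_eq_zero hL20 htrans
    refine h.subset ?_
    intro z hz
    simp only [Set.mem_setOf_eq] at hz ⊢
    rw [heval2]; exact hz
  -- pick a non-zero rational off that finite set
  have hinf : (Set.range (fun q : ℚ => (q : ℂ)) \ {0}).Infinite := by
    refine Set.Infinite.sdiff ?_ (Set.finite_singleton 0)
    exact Set.infinite_range_of_injective Rat.cast_injective
  obtain ⟨c, ⟨⟨q, rfl⟩, hq0⟩, hqL⟩ := (hinf.sdiff hfin).nonempty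
  have hq : (q : ℂ) ≠ 0 := hq0
  have hqL' : MvPolynomial.aeval (fun _ : Fin 1 => (q : ℂ)) L ≠ 0 := hqL
  refine ⟨q, by exact_mod_cast hq, ?_⟩
  -- `m(·, q)` as a rational polynomial
  set Mq : Polynomial ℚ := M.map (MvPolynomial.aeval (fun _ : Fin 1 => q) :
      MvPolynomial (Fin 1) ℚ →ₐ[ℚ] ℚ).toRingHom with hMq
  have hcoef : ∀ r : MvPolynomial (Fin 1) ℚ, (MvPolynomial.aeval (fun _ : Fin 1 => (q : ℂ)) r : ℂ) =
      algebraMap ℚ ℂ (MvPolynomial.aeval (fun _ : Fin 1 => q) r) := by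
    intro r
    have e : (fun _ : Fin 1 => (q : ℂ)) = algebraMap ℚ ℂ ∘ fun _ : Fin 1 => q := by
      funext i; rfl
    rw [e, MvPolynomial.aeval_algebraMap_apply]
  have hMqC : M.map (MvPolynomial.aeval (fun _ : Fin 1 => (q : ℂ)) :
      MvPolynomial (Fin 1) ℚ →ₐ[ℚ] ℂ).toRingHom = Mq.map (algebraMap ℚ ℂ) := by
    rw [hMq, Polynomial.map_map]
    congr 1
    exact RingHom.ext fun r => hcoef r
  have hMq0 : Mq ≠ 0 := by
    intro h0
    apply hqL'
    have hlc : (MvPolynomial.aeval (fun _ : Fin 1 => q) L) = 0 := by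
      have := congrArg Polynomial.leadingCoeff h0
      rw [Polynomial.leadingCoeff_zero] at this
      by_contra hne
      rw [hMq, Polynomial.leadingCoeff_map_of_leadingCoeff_ne_zero _ (by exact hne)] at this
      exact hne this
    rw [hcoef, hlc, map_zero]
  intro hzero
  -- then `e^q` would be algebraic
  have halg : IsAlgebraic ℚ (cexp q) := by
    refine ⟨Mq, hMq0, ?_⟩
    rw [Polynomial.aeval_def, ← Polynomial.eval_map, ← hMqC, eval_map_finSuccEquiv]
    exact hzero
  have hqalg : IsAlgebraic ℚ ((q : ℚ) : ℂ) := by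
    have h := isAlgebraic_algebraMap (R := ℚ) (A := ℂ) q
    rwa [eq_ratCast] at h
  exact transcendental_exp_holds hqalg hq halg

/-- **Zeros of a non-zero exponential polynomial are isolated** (identity theorem on `ℂ`). -/
theorem expPoly_eventually_ne {m : MvPolynomial (Fin 2) ℚ} (hm : m ≠ 0) (z₀ : ℂ) :
    ∀ᶠ s in 𝓝[≠] z₀, expPoly[m, s] ≠ 0 := by
  rcases (analyticAt_expPoly m z₀).eventually_eq_zero_or_eventually_ne_zero with h | h
  · exfalso
    obtain ⟨q, -, hq⟩ := exists_rat_expPoly_ne_zero hm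
    have hall := AnalyticOnNhd.eqOn_zero_of_preconnected_of_eventuallyEq_zero
      (f := fun s => expPoly[m, s]) (U := Set.univ) (fun s _ => analyticAt_expPoly m s)
      isPreconnected_univ (Set.mem_univ z₀) h
    exact hq (hall (Set.mem_univ _))
  · exact h

/-- Hence **bounded sets of zeros of a non-zero exponential polynomial are finite**. -/
theorem expPoly_zeros_finite {m : MvPolynomial (Fin 2) ℚ} (hm : m ≠ 0) (R : ℝ) :
    {s : ℂ | ‖s‖ ≤ R ∧ expPoly[m, s] = 0}.Finite := by
  by_contra hinf
  have hinf' : {s : ℂ | ‖s‖ ≤ R ∧ expPoly[m, s] = 0}.Infinite := hinf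
  have hsub : {s : ℂ | ‖s‖ ≤ R ∧ expPoly[m, s] = 0} ⊆ Metric.closedBall (0 : ℂ) R := by
    intro s hs; simpa using hs.1
  obtain ⟨z₀, -, hacc⟩ := hinf'.exists_accPt_of_subset_isCompact (isCompact_closedBall 0 R) hsub
  rw [accPt_iff_frequently_nhdsNE] at hacc
  have h := expPoly_eventually_ne hm z₀
  obtain ⟨s, hs, hs'⟩ := (hacc.and_eventually h).exists
  exact hs' hs.2

/-- **E-SPECIAL TUPLES, ANY RANK: bounded sets of locus points are finite.**  If every coordinate of
`x ∈ ℂⁿ` is *E-special* — `xᵢ` and `e^{xᵢ}` algebraically dependent, witnessed by `mᵢ ≠ 0` in `ℚ[T, S]`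
with `mᵢ(e^{xᵢ}, xᵢ) = 0` (automatic at rank 2, and in the log sector at every rank) — then the tuples `v`
satisfying every ℚ-relation of `(x, eˣ)` with `‖vᵢ‖ ≤ R` form a finite set: `𝒵_W ⊆ ∏ᵢ Z(mᵢ)` is closed
discrete with no finite accumulation point. -/
theorem locusPts_bounded_finite_of_special {n : ℕ} {x : Fin n → ℂ}
    (hdep : ∀ i, ∃ m : MvPolynomial (Fin 2) ℚ, m ≠ 0 ∧ MvPolynomial.aeval ![cexp (x i), x i] m = 0)
    (R : ℝ) :
    {v : Fin n → ℂ | (∀ i, ‖v i‖ ≤ R) ∧ ∀ p : MvPolynomial (Fin n ⊕ Fin n) ℚ,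
        MvPolynomial.aeval (Sum.elim x (cexp ∘ x)) p = 0 →
        MvPolynomial.aeval (Sum.elim v (cexp ∘ v)) p = 0}.Finite := by
  choose m hm0 hm using hdep
  -- the relation `mᵢ(Yᵢ, Xᵢ)` of `(x, eˣ)` transfers to every `v` on the locus
  have htrans : ∀ i (v : Fin n → ℂ), (∀ p : MvPolynomial (Fin n ⊕ Fin n) ℚ,
      MvPolynomial.aeval (Sum.elim x (cexp ∘ x)) p = 0 →
      MvPolynomial.aeval (Sum.elim v (cexp ∘ v)) p = 0) → expPoly[m i, v i] = 0 := by
    intro i v hv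
    set r : Fin 2 → Fin n ⊕ Fin n := ![Sum.inr i, Sum.inl i] with hr
    have hre : ∀ w : Fin n → ℂ, MvPolynomial.aeval (Sum.elim w (cexp ∘ w)) (MvPolynomial.rename r (m i)) =
        expPoly[m i, w i] := by
      intro w
      have e : (Sum.elim w (cexp ∘ w) ∘ r) = ![cexp (w i), w i] := by
        funext j; fin_cases j <;> rfl
      rw [MvPolynomial.aeval_rename, expPoly_def, e]
    have h0 : MvPolynomial.aeval (Sum.elim x (cexp ∘ x)) (MvPolynomial.rename r (m i)) = 0 := by
      rw [hre]; exact hm i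
    have := hv _ h0
    rwa [hre] at this
  have hZ : ∀ i, {s : ℂ | ‖s‖ ≤ R ∧ expPoly[m i, s] = 0}.Finite := fun i => expPoly_zeros_finite (hm0 i) R
  refine (Set.Finite.pi hZ).subset ?_
  intro v hv
  rw [Set.mem_univ_pi]
  intro i
  exact ⟨hv.1 i, htrans i v hv.2⟩

/-- **At rank 2 every coordinate is E-special** (`trdeg ℚ(xᵢ, e^{xᵢ}) ≤ trdeg ℚ(x, eˣ) ≤ 1`), so
**BOUNDED SETS OF TUPLES ON THE LOCUS ARE FINITE**: for `x ∈ ℂ²` with `trdeg ℚ(x,eˣ) < 2` (e.g. a rank-2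
first failure — but neither linear independence nor `SchanuelRank` is used) the tuples `v` satisfying
every ℚ-relation of `(x, eˣ)` with norm `≤ R` form a finite set; `𝒵_W ⊆ Z(m₀) × Z(m₁)` is a closed
discrete set with NO finite accumulation point, and the locus mates are finite iff BOUNDED. -/
theorem locusPts_bounded_finite {x : Fin 2 → ℂ}
    (htr : Algebra.trdeg ℚ ↥(IntermediateField.adjoin ℚ (range x ∪ range (cexp ∘ x))) < (2 : Cardinal))
    (R : ℝ) :
    {v : Fin 2 → ℂ | (∀ i, ‖v i‖ ≤ R) ∧ ∀ p : MvPolynomial (Fin 2 ⊕ Fin 2) ℚ,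
        MvPolynomial.aeval (Sum.elim x (cexp ∘ x)) p = 0 →
        MvPolynomial.aeval (Sum.elim v (cexp ∘ v)) p = 0}.Finite := by
  refine locusPts_bounded_finite_of_special (fun i => ?_) R
  exact exists_mvPolynomial_of_trdeg_lt_two htr
    (IntermediateField.subset_adjoin ℚ _ (Or.inr ⟨i, rfl⟩))
    (IntermediateField.subset_adjoin ℚ _ (Or.inl ⟨i, rfl⟩))


/-- **At rank 2 each coordinate of every tuple on the locus satisfies a FIXED non-zero exponential
polynomial equation**: for `x : Fin 2 → ℂ` with `trdeg ℚ(x, eˣ) < 2` and `i`, there is `m ≠ 0` in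
`ℚ[T, S]` with `m(e^{vᵢ}, vᵢ) = 0` for every `v` satisfying the ℚ-relations of `(x, eˣ)`. -/
theorem exists_coord_expPoly {x : Fin 2 → ℂ}
    (htr : Algebra.trdeg ℚ ↥(IntermediateField.adjoin ℚ (range x ∪ range (cexp ∘ x))) < (2 : Cardinal))
    (i : Fin 2) :
    ∃ m : MvPolynomial (Fin 2) ℚ, m ≠ 0 ∧ ∀ v : Fin 2 → ℂ,
      (∀ p : MvPolynomial (Fin 2 ⊕ Fin 2) ℚ,
        MvPolynomial.aeval (Sum.elim x (cexp ∘ x)) p = 0 →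
        MvPolynomial.aeval (Sum.elim v (cexp ∘ v)) p = 0) → expPoly[m, v i] = 0 := by
  have ha : cexp (x i) ∈ IntermediateField.adjoin ℚ (range x ∪ range (cexp ∘ x)) :=
    IntermediateField.subset_adjoin ℚ _ (Or.inr ⟨i, rfl⟩)
  have hb : x i ∈ IntermediateField.adjoin ℚ (range x ∪ range (cexp ∘ x)) :=
    IntermediateField.subset_adjoin ℚ _ (Or.inl ⟨i, rfl⟩)
  obtain ⟨m, hm0, hm⟩ := exists_mvPolynomial_of_trdeg_lt_two htr ha hb
  refine ⟨m, hm0, fun v hv => ?_⟩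
  -- the relation `m(Yᵢ, Xᵢ)` of `(x, eˣ)` transfers to `v`
  set r : Fin 2 → Fin 2 ⊕ Fin 2 := ![Sum.inr i, Sum.inl i] with hr
  have hre : ∀ w : Fin 2 → ℂ, MvPolynomial.aeval (Sum.elim w (cexp ∘ w)) (MvPolynomial.rename r m) =
      expPoly[m, w i] := by
    intro w
    have e : (Sum.elim w (cexp ∘ w) ∘ r) = ![cexp (w i), w i] := by
      funext j; fin_cases j <;> rfl
    rw [MvPolynomial.aeval_rename, expPoly_def, e]
  have h0 : MvPolynomial.aeval (Sum.elim x (cexp ∘ x)) (MvPolynomial.rename r m) = 0 := by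
    rw [hre]; exact hm
  have := hv _ h0
  rwa [hre] at this


/-- **`CruxRankTwo` (the crux at its first open rank, inlined) follows from BOUNDEDNESS of the mates of
rank-2 first failures**, with the landed free definable isolation `Negative.isolationFree`. -/
theorem cruxRankTwo_of_bounded'
    (h : ∀ x : Fin 2 → ℂ, LinearIndependent ℚ x →
      Algebra.trdeg ℚ ↥(IntermediateField.adjoin ℚ (Set.range x ∪ Set.range (cexp ∘ x))) < (2 : Cardinal) →
      Bornology.IsBounded {x' : Fin 2 → ℂ | LinearIndependent ℚ x' ∧
        ∀ p : MvPolynomial (Fin 2 ⊕ Fin 2) ℚ,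
          MvPolynomial.aeval (Sum.elim x (cexp ∘ x)) p = 0 →
          MvPolynomial.aeval (Sum.elim x' (cexp ∘ x')) p = 0}) :
    ∀ x : Fin 2 → ℂ, LinearIndependent ℚ x →
      Algebra.trdeg ℚ ↥(IntermediateField.adjoin ℚ (Set.range x ∪ Set.range (cexp ∘ x))) < (2 : Cardinal) →
      ∀ i, x i ∈ expAcl := by
  intro x hli htr i
  refine isolationFree hli ?_ i
  obtain ⟨R, hR⟩ := (h x hli htr).subset_closedBall 0
  refine (locusPts_bounded_finite htr R).subset fun x' hx' => ⟨fun j => ?_, hx'.2⟩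
  have h1 := hR hx'
  rw [Metric.mem_closedBall, dist_zero_right] at h1
  exact (norm_le_pi_norm x' j).trans h1

/-! ## Registered stub (crux stmt-Schanuel-0969, line `kernel-arithmetic-selection`, gen 19 toolkit) -/

/-- **Registered stub `stub_locusPtsBoundedFinite` (PROVED)** — at rank 2, BOUNDED SETS OF TUPLES ON THE ℚ-LOCUS OF
`(x, eˣ)` ARE FINITE (`trdeg ℚ(x, eˣ) < 2`; uncurried form of `locusPts_bounded_finite`). -/
theorem stub_locusPtsBoundedFinite : ∀ (x : Fin 2 → ℂ), Algebra.trdeg ℚ ↥(IntermediateField.adjoin ℚ (Set.range x ∪ Set.range (Complex.exp ∘ x))) < (2 : Cardinal) → ∀ R : ℝ, Set.Finite {v : Fin 2 → ℂ | (∀ i, ‖v i‖ ≤ R) ∧ ∀ p : MvPolynomial (Fin 2 ⊕ Fin 2) ℚ, MvPolynomial.aeval (Sum.elim x (Complex.exp ∘ x)) p = 0 → MvPolynomial.aeval (Sum.elim v (Complex.exp ∘ v)) p = 0} :=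
  fun _ htr R => locusPts_bounded_finite htr R

end Summit.Schanuel.Schanuel.Cruxes.MinimalCounterexampleInAcl.KernelArithmeticSelection.MateGrowth

end
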